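import Mathlib
import Summits.AnomalousDissipation.AnomalousDissipation.Theorems.SolenoidalFractalHomogenisationLagrangianStepW7SlotStepOn
import Summits.AnomalousDissipation.AnomalousDissipation.Theorems.SolenoidalFractalHomogenisationLagrangianStepW7Envelope
import Summits.AnomalousDissipation.AnomalousDissipation.Theorems.SolenoidalFractalHomogenisationLagrangianStepW7Period
import Summits.AnomalousDissipation.AnomalousDissipation.Theorems.SolenoidalFractalHomogenisationLagrangianStepCellChainPair
import Summits.AnomalousDissipation.AnomalousDissipation.Theorems.SolenoidalFractalHomogenisationLagrangianStepCellChainSlotWindow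
import Summits.AnomalousDissipation.AnomalousDissipation.Theorems.SolenoidalFractalHomogenisationLagrangianStepCellChainSlotStepInputs
import Summits.AnomalousDissipation.AnomalousDissipation.Theorems.SolenoidalFractalHomogenisationPermissibleFractalCarrierLayers
import HarnessLib

/-!
# K1L_D (stmt-AnomalousDissipation-27980), W7 ENGINE S1b — THE CELL SLOT CONTRACTION
# (the abstract slot step `W7Slot.slot_step_on` instantiated on the weak-solution mode calculus S1a of the flat tensor cell problem)
# (helper; `--supports stmt-AnomalousDissipation-27980 --as helper`)

Assembly step (R-a) of the W7 high-label decay engine (`stub_compactRange` / `stub_largeR`, registry v9): for a weak solution `u` of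
`IsWeakTensorPassiveVectorOn 0 T 𝔹 (W₁.cell n) F u` (`NearIso 𝔹 lo hi`, `0 < lo`, `OddSmall 𝔹 β`, triangle envelopes `ramp = 1/2`), the energy
representative `E` of `CellChain.exists_energyRep_cell` (prover ad-k1l-cellLawV-w1 g4), ONE slot `s` in period `p` whose absolute window
`[pP + start s, pP + start s + τ_s]` lies in `[0,T]`, and ONE slow chain `K₀ + j·K_s` (`K_s = n·m_s`, `|j| ≤ 2`, the ten vectors `±K_j` distinct)
satisfying the window inequalities `dmin, dtwo, Dmax`, the Young constraints (c1)–(c4), the cap (c5) and the drain floor `q`, and off which every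
carried mode dissipates at rate `≥ dmin/2`:
**`cell_slot_contraction`** — `E(pP + start s + τ_s) ≤ exp(−ε c² q τ_s/27) · E(pP + start s)`, `c = |ê_s·K₀|(1/n)/(2|m_s|)`.
Ingredients: the envelope package (`…W7Envelope`), the period
bricks `slot_integral_lower`, `slot_floor_of_cap` (`…W7Period`), S1a's slot-shaped inputs `…CellChainSlotStepInputs` (`ae_uIcc_hasDerivAt_dW0C/…`,
`kdot_gauge_modeRep`, `absolutelyContinuousOnInterval_gauge_modeRep`, `ae_uIcc_hasDerivAt_energy`, `five_norm_sq_le_energy`, `ae_uIcc_pair_split`),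
and `slot_step_on`.  Also here: `rate_integrand_eq`, `slot_rate_floor` (the cap `min dmin dtwo` is inactive; the triangle gives `∫ ≥ εc²qτ/27`).
No definitions, no sorry.  W7 assembly owner: prover ad-sawtooth-k1loc-p1 g11.  NOT a proof of the crux / of AD; rung F-D1.A0.
[cite: BedrossianCotiZelati2017, §2 (hypocoercivity functional with a cross term, Grönwall)] [problem: turb]
-/

set_option linter.dupNamespace false

noncomputable section

namespace Summit.AnomalousDissipation.AnomalousDissipation.Theorems.SolenoidalFractalHomogenisation.LagrangianStep.W7Cell

open Set Real MeasureTheory intervalIntegral Filter Topology Function Complex UnitAddTorus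
open scoped InnerProductSpace ComplexConjugate
open Literature.Analysis Literature.Analysis.FunctionSpaces Literature.Analysis.FunctionSpaces.Torus
open Literature.Analysis.FluidPDE Literature.Analysis.FluidPDE.Torus Literature.Analysis.FluidPDE.LatticeShear
open Summit.AnomalousDissipation.AnomalousDissipation.Theorems.SolenoidalFractalHomogenisation.LagrangianStep.ThreeMode
open Summit.AnomalousDissipation.AnomalousDissipation.Theorems.SolenoidalFractalHomogenisation.LagrangianStep.W7Engine
open Summit.AnomalousDissipation.AnomalousDissipation.Theorems.SolenoidalFractalHomogenisation.LagrangianStep.W7Slot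
open Summit.AnomalousDissipation.AnomalousDissipation.Theorems.SolenoidalFractalHomogenisation.LagrangianStep.CellChain
open Summit.AnomalousDissipation.AnomalousDissipation.Theorems.SolenoidalFractalHomogenisation.PermissibleCarrier
  (trapezoid_nonneg trapezoid_le_one continuous_trapezoid)

variable {k₀ : ℕ}

/-! ## §1 The rate integrand and the slot floor (pure real analysis on the triangle) -/

/-- The cap `min dmin dtwo` in the slot-step rate is inactive under (c1), (c3), `q ≤ 2`, `0 ≤ A ≤ 1`, and the rate is
`(εc²q/2)A² − 8ε²c²/(dmin τ²)`. -/
theorem rate_integrand_eq {ε c q dmin dtwo τ A : ℝ} (hε : 0 ≤ ε) (hq2 : q ≤ 2) (hA0 : 0 ≤ A) (hA1 : A ≤ 1)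
    (hdmin : 0 < dmin) (c1 : 8 * ε * c ^ 2 ≤ dmin) (c3 : ε * c ^ 2 ≤ dtwo) :
    min (min (ε * c ^ 2 * (q * A ^ 2 / 2 - 8 * ε / (dmin * τ ^ 2))) (min dmin dtwo) / (9 / 8))
        (min (ε * c ^ 2 * (q * A ^ 2 / 2 - 8 * ε / (dmin * τ ^ 2))) (min dmin dtwo) / (7 / 8))
      = min ((ε * c ^ 2 * q / 2 * A ^ 2 - 8 * ε ^ 2 * c ^ 2 / (dmin * τ ^ 2)) / (9 / 8))
        ((ε * c ^ 2 * q / 2 * A ^ 2 - 8 * ε ^ 2 * c ^ 2 / (dmin * τ ^ 2)) / (7 / 8)) := by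
  have hA2 : A ^ 2 ≤ 1 := by nlinarith
  have hsub0 : 0 ≤ 8 * ε / (dmin * τ ^ 2) := by positivity
  have hεc2 : 0 ≤ ε * c ^ 2 := mul_nonneg hε (sq_nonneg c)
  have hqA : q * A ^ 2 / 2 - 8 * ε / (dmin * τ ^ 2) ≤ 1 := by nlinarith [sq_nonneg A]
  have hX : ε * c ^ 2 * (q * A ^ 2 / 2 - 8 * ε / (dmin * τ ^ 2)) ≤ ε * c ^ 2 := by nlinarith
  have hmin : min (ε * c ^ 2 * (q * A ^ 2 / 2 - 8 * ε / (dmin * τ ^ 2))) (min dmin dtwo)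
      = ε * c ^ 2 * (q * A ^ 2 / 2 - 8 * ε / (dmin * τ ^ 2)) :=
    min_eq_left (le_min (by linarith) (by linarith))
  rw [hmin]
  congr 1 <;> ring

/-- **The slot floor on the triangle**: with `A = trapezoid t₀ τ (1/2)` and the cap (c5) `64·27·ε ≤ 7 q dmin τ²`, the slot-step rate integral is
at least `εc²qτ/27` (`slot_integral_lower` with `∫A² = τ/3`, `slot_floor_of_cap`, `rate_integrand_eq`). -/
theorem slot_rate_floor {ε c q dmin dtwo τ ρ t₀ : ℝ} (hε : 0 ≤ ε) (hq0 : 0 ≤ q) (hq2 : q ≤ 2) (hdmin : 0 < dmin) (hτ : 0 < τ)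
    (hρ : ρ = 1 / 2) (c1 : 8 * ε * c ^ 2 ≤ dmin) (c3 : ε * c ^ 2 ≤ dtwo) (c5 : 64 * 27 * ε ≤ 7 * q * dmin * τ ^ 2) :
    ε * c ^ 2 * q * τ / 27 ≤ ∫ s' in t₀..(t₀ + τ),
      min (min (ε * c ^ 2 * (q * LatticeWord.trapezoid t₀ τ ρ s' ^ 2 / 2 - 8 * ε / (dmin * τ ^ 2))) (min dmin dtwo) / (9 / 8))
        (min (ε * c ^ 2 * (q * LatticeWord.trapezoid t₀ τ ρ s' ^ 2 / 2 - 8 * ε / (dmin * τ ^ 2))) (min dmin dtwo) / (7 / 8)) := by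
  have hρ0 : 0 < ρ := by rw [hρ]; norm_num
  have hρ2 : ρ ≤ 1 / 2 := by rw [hρ]
  have hptw : ∀ s' : ℝ,
      min (min (ε * c ^ 2 * (q * LatticeWord.trapezoid t₀ τ ρ s' ^ 2 / 2 - 8 * ε / (dmin * τ ^ 2))) (min dmin dtwo) / (9 / 8))
          (min (ε * c ^ 2 * (q * LatticeWord.trapezoid t₀ τ ρ s' ^ 2 / 2 - 8 * ε / (dmin * τ ^ 2))) (min dmin dtwo) / (7 / 8))
        = min ((ε * c ^ 2 * q / 2 * LatticeWord.trapezoid t₀ τ ρ s' ^ 2 - 8 * ε ^ 2 * c ^ 2 / (dmin * τ ^ 2)) / (9 / 8))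
          ((ε * c ^ 2 * q / 2 * LatticeWord.trapezoid t₀ τ ρ s' ^ 2 - 8 * ε ^ 2 * c ^ 2 / (dmin * τ ^ 2)) / (7 / 8)) :=
    fun s' => rate_integrand_eq hε hq2 (trapezoid_nonneg _ _ _ _) (trapezoid_le_one _ _ _ _) hdmin c1 c3
  simp only [hptw]
  have hA2 : ∫ s' in t₀..(t₀ + τ), LatticeWord.trapezoid t₀ τ ρ s' ^ 2 = ((t₀ + τ) - t₀) / 3 := by
    rw [integral_trapezoid_sq_anchored t₀ hτ hρ0 hρ2, hρ]; ring
  have hlow := slot_integral_lower (A := fun s' => LatticeWord.trapezoid t₀ τ ρ s') (α := ε * c ^ 2 * q / 2)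
    (β₀ := 8 * ε ^ 2 * c ^ 2 / (dmin * τ ^ 2)) (by linarith : t₀ ≤ t₀ + τ) (by positivity) (by positivity)
    (continuous_trapezoid _ _ _) hA2
  rw [show t₀ + τ - t₀ = τ by ring] at hlow
  exact (slot_floor_of_cap (c := c) hε hq0 hdmin hτ c5).trans hlow

/-! ## §2 The cell slot contraction -/

/-- **THE CELL SLOT CONTRACTION** (W7 engine (R-a); see the module docstring): on the window of slot `s`, period `p`,
`E(pP + start s + τ_s) ≤ exp(−ε c² q τ_s/27)·E(pP + start s)`, `c = |ê_s·K₀|(1/n)/(2|m_s|)`.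
[cite: BedrossianCotiZelati2017, §2 (hypocoercivity functional with a cross term, Grönwall)] -/
theorem cell_slot_contraction (W₁ : LatticeWord k₀) (n : ℕ) {T : ℝ} (hT : 0 < T) {𝔹 : Torus.Visc4 (Fin 3)}
    {lo hi β : ℝ} (h𝔹 : Torus.NearIso 𝔹 lo hi) (hlo : 0 < lo) (hhi : 0 ≤ hi) (hodd : Torus.OddSmall 𝔹 β) (hβ : 0 ≤ β)
    {F : UnitAddTorus (Fin 3) → EuclideanSpace ℝ (Fin 3)} {u : ℝ → UnitAddTorus (Fin 3) → EuclideanSpace ℝ (Fin 3)}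
    (hF : Integrable F volume) (h : Torus.IsWeakTensorPassiveVectorOn 0 T 𝔹 (W₁.cell n) F u) (hramp : W₁.ramp = 1 / 2)
    {E Q : ℝ → ℝ} (hEcont : ContinuousOn E (Icc 0 T))
    (hEac : ∀ a ∈ Icc 0 T, ∀ b' ∈ Icc 0 T, AbsolutelyContinuousOnInterval E a b')
    (hEae : ∀ᵐ t ∂(volume.restrict (Ioo 0 T)), E t = ∫ x, ‖u t x‖ ^ 2)
    (hEd : ∀ᵐ t ∂(volume : Measure ℝ), t ∈ Ioo 0 T → HasDerivAt E (-(2 * Q t)) t)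
    (hQS : ∀ᵐ t ∂(volume.restrict (Ioo 0 T)), ∀ S : Finset (Fin 3 → ℤ),
      4 * Real.pi ^ 2 * ∑ k ∈ S, (⟪mFourierCoeff (EuclideanSpace.complexify ∘ u t) k,
        Torus.symbT 𝔹 k (mFourierCoeff (EuclideanSpace.complexify ∘ u t) k)⟫_ℂ).re ≤ Q t)
    (s : Fin k₀) (p : ℤ) (ht₀ : 0 ≤ (p * W₁.period + W₁.start s)) (ht₁ : ((p * W₁.period + W₁.start s) + (W₁.phase s).τ) ≤ T)
    (K0 : Fin 3 → ℤ) (hKs : (fun i => (W₁.phase s).m i * (n : ℤ)) ≠ 0) (hKp : (K0 + (1:ℤ) • (fun i => (W₁.phase s).m i * (n : ℤ))) ≠ 0) (hKm : (K0 + (-1:ℤ) • (fun i => (W₁.phase s).m i * (n : ℤ))) ≠ 0)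
    (hdisj : ∀ j ∈ ({-2, -1, 0, 1, 2} : Finset ℤ), ∀ j' ∈ ({-2, -1, 0, 1, 2} : Finset ℤ),
      K0 + j • (fun i => (W₁.phase s).m i * (n : ℤ)) ≠ -(K0 + j' • (fun i => (W₁.phase s).m i * (n : ℤ))))
    {dmin dtwo Dmax ε q c : ℝ} (hdmin : 0 < dmin) (hdtwo : 0 ≤ dtwo) (hε : 0 ≤ ε) (hq0 : 0 ≤ q) (hq2 : q ≤ 2)
    (hc : c = |∑ a, (W₁.phase s).e a * (K0 a : ℝ)| * (1 / (n : ℝ)) / (2 * ‖latticeVec (W₁.phase s).m‖))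
    (hdp : dmin ≤ 4 * Real.pi ^ 2 * lo * freqNormSq (K0 + (1:ℤ) • (fun i => (W₁.phase s).m i * (n : ℤ)))) (hdm : dmin ≤ 4 * Real.pi ^ 2 * lo * freqNormSq (K0 + (-1:ℤ) • (fun i => (W₁.phase s).m i * (n : ℤ))))
    (hdpp : dtwo ≤ 4 * Real.pi ^ 2 * lo * freqNormSq (K0 + (2:ℤ) • (fun i => (W₁.phase s).m i * (n : ℤ)))) (hdmm : dtwo ≤ 4 * Real.pi ^ 2 * lo * freqNormSq (K0 + (-2:ℤ) • (fun i => (W₁.phase s).m i * (n : ℤ))))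
    (hDp : 4 * Real.pi ^ 2 * (hi + β / 2) * freqNormSq (K0 + (1:ℤ) • (fun i => (W₁.phase s).m i * (n : ℤ))) ≤ Dmax)
    (hDm : 4 * Real.pi ^ 2 * (hi + β / 2) * freqNormSq (K0 + (-1:ℤ) • (fun i => (W₁.phase s).m i * (n : ℤ))) ≤ Dmax) (hdD : dmin ≤ Dmax)
    (c1 : 8 * ε * c ^ 2 ≤ dmin) (c2 : 4 * ε * Dmax ^ 2 ≤ dmin) (c3 : ε * c ^ 2 ≤ dtwo)
    (c4 : 32 * ε ^ 2 * c ^ 2 * (4 * Real.pi ^ 2 * (hi + β / 2) * freqNormSq (K0 + (0:ℤ) • (fun i => (W₁.phase s).m i * (n : ℤ)))) ^ 2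
      ≤ (4 * Real.pi ^ 2 * lo * freqNormSq (K0 + (0:ℤ) • (fun i => (W₁.phase s).m i * (n : ℤ)))) * dmin)
    (c5 : 64 * 27 * ε ≤ 7 * q * dmin * (W₁.phase s).τ ^ 2)
    (hqw : ∀ z : EuclideanSpace ℂ (Fin 3), kdot (K0 + (0:ℤ) • (fun i => (W₁.phase s).m i * (n : ℤ))) z = 0 →
      q * ‖z‖ ^ 2 ≤ ‖transversalProj (K0 + (1:ℤ) • (fun i => (W₁.phase s).m i * (n : ℤ))) z‖ ^ 2 + ‖transversalProj (K0 + (-1:ℤ) • (fun i => (W₁.phase s).m i * (n : ℤ))) z‖ ^ 2)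
    (hgap : ∀ᵐ t ∂(volume.restrict (Ioo 0 T)), ∀ k : Fin 3 → ℤ,
      (∀ j ∈ ({-2, -1, 0, 1, 2} : Finset ℤ), k ≠ K0 + j • (fun i => (W₁.phase s).m i * (n : ℤ)) ∧ k ≠ -(K0 + j • (fun i => (W₁.phase s).m i * (n : ℤ)))) →
      mFourierCoeff (EuclideanSpace.complexify ∘ u t) k ≠ 0 → dmin ≤ 8 * Real.pi ^ 2 * lo * freqNormSq k) :
    E ((p * W₁.period + W₁.start s) + (W₁.phase s).τ) ≤ Real.exp (-(ε * c ^ 2 * q * (W₁.phase s).τ / 27)) * E (p * W₁.period + W₁.start s) := by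
  have hτ : 0 < (W₁.phase s).τ := (W₁.phase s).τ_pos
  have hρ : 0 < W₁.ramp := W₁.ramp_pos
  have hρ2 : W₁.ramp ≤ 1 / 2 := W₁.ramp_le
  have hlt : (p * W₁.period + W₁.start s) < ((p * W₁.period + W₁.start s) + (W₁.phase s).τ) := by linarith
  have hτeq : ((p * W₁.period + W₁.start s) + (W₁.phase s).τ) - (p * W₁.period + W₁.start s) = (W₁.phase s).τ := by ring
  have ht0I : (p * W₁.period + W₁.start s) ∈ Icc 0 T := ⟨ht₀, by linarith⟩
  have ht1I : ((p * W₁.period + W₁.start s) + (W₁.phase s).τ) ∈ Icc 0 T := ⟨by linarith, ht₁⟩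
  have hsubI : Icc (p * W₁.period + W₁.start s) ((p * W₁.period + W₁.start s) + (W₁.phase s).τ) ⊆ Icc 0 T := Icc_subset_Icc ht₀ ht₁
  have hIcc : uIcc (p * W₁.period + W₁.start s) ((p * W₁.period + W₁.start s) + (W₁.phase s).τ) = Icc (p * W₁.period + W₁.start s) ((p * W₁.period + W₁.start s) + (W₁.phase s).τ) := uIcc_of_le hlt.le
  -- the sign choice `σ = sgn(ê_s·K₀)` and the link constant `c_σ = c ≥ 0`
  obtain ⟨σ, hσ, hσθ⟩ : ∃ σ : ℝ, (σ = 1 ∨ σ = -1) ∧ σ * (∑ a, (W₁.phase s).e a * (K0 a : ℝ))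
      = |∑ a, (W₁.phase s).e a * (K0 a : ℝ)| := ⟨_, (sgn_choice _).1, (sgn_choice _).2⟩
  have hcσ : (σ * (∑ a, (W₁.phase s).e a * (K0 a : ℝ)) * (1 / (n : ℝ)) / (2 * ‖latticeVec (W₁.phase s).m‖)) = c := by rw [hc, hσθ]
  have hc0 : 0 ≤ c := by rw [hc]; positivity
  -- the tensor seen by the chain ODE
  have h𝔹' : Torus.NearIso (Torus.majorTranspose 𝔹) lo hi := (Torus.nearIso_majorTranspose_iff 𝔹 lo hi).2 h𝔹
  have hodd' : Torus.OddSmall (Torus.majorTranspose 𝔹) β := hodd.majorTranspose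
  -- the envelope of the slot
  obtain ⟨Ad, hAd2', hAd⟩ := exists_ae_hasDerivAt_trapezoid (p * W₁.period + W₁.start s) hτ hρ hρ2
  have hAd2 : ∀ᵐ t, t ∈ uIcc (p * W₁.period + W₁.start s) ((p * W₁.period + W₁.start s) + (W₁.phase s).τ) → Ad t ^ 2 ≤ 4 / (((p * W₁.period + W₁.start s) + (W₁.phase s).τ) - (p * W₁.period + W₁.start s)) ^ 2 := by
    refine Filter.Eventually.of_forall fun t _ => ?_
    rw [hτeq]
    have h1 := hAd2' t
    rw [hramp] at h1
    have h2 : (1 / (1 / 2 * (W₁.phase s).τ)) ^ 2 = 4 / (W₁.phase s).τ ^ 2 := by field_simp; ring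
    rw [h2] at h1
    exact h1
  have hAd1 : ∀ᵐ t, t ∈ uIcc (p * W₁.period + W₁.start s) ((p * W₁.period + W₁.start s) + (W₁.phase s).τ) → HasDerivAt (fun t => LatticeWord.trapezoid (p * W₁.period + W₁.start s) (W₁.phase s).τ W₁.ramp t) (Ad t) t := hAd.mono fun t ht _ => ht
  have hA01 : ∀ t ∈ Icc (p * W₁.period + W₁.start s) ((p * W₁.period + W₁.start s) + (W₁.phase s).τ), 0 ≤ LatticeWord.trapezoid (p * W₁.period + W₁.start s) (W₁.phase s).τ W₁.ramp t ∧ LatticeWord.trapezoid (p * W₁.period + W₁.start s) (W₁.phase s).τ W₁.ramp t ≤ 1 :=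
    fun t _ => ⟨trapezoid_nonneg _ _ _ _, trapezoid_le_one _ _ _ _⟩
  -- (S1a) the chain ODE on the window, link `c·A`
  have hd0 : ∀ᵐ t, t ∈ uIcc (p * W₁.period + W₁.start s) ((p * W₁.period + W₁.start s) + (W₁.phase s).τ) → HasDerivAt (fun x => ((σ : ℂ) * starRingEnd ℂ (Complex.exp ((W₁.phase s).φ * Complex.I))) ^ (0:ℤ) • modeRep W₁ n 𝔹 F u (K0 + (0:ℤ) • (fun i => (W₁.phase s).m i * (n : ℤ))) x)
      (dW0C (c * LatticeWord.trapezoid (p * W₁.period + W₁.start s) (W₁.phase s).τ W₁.ramp t) (K0 + (0:ℤ) • (fun i => (W₁.phase s).m i * (n : ℤ))) (((σ : ℂ) * starRingEnd ℂ (Complex.exp ((W₁.phase s).φ * Complex.I))) ^ (1:ℤ) • modeRep W₁ n 𝔹 F u (K0 + (1:ℤ) • (fun i => (W₁.phase s).m i * (n : ℤ))) t) (((σ : ℂ) * starRingEnd ℂ (Complex.exp ((W₁.phase s).φ * Complex.I))) ^ (-1:ℤ) • modeRep W₁ n 𝔹 F u (K0 + (-1:ℤ) • (fun i => (W₁.phase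 s).m i * (n : ℤ))) t) (Torus.modalAdjGen (Torus.majorTranspose 𝔹) (K0 + (0:ℤ) • (fun i => (W₁.phase s).m i * (n : ℤ))) (((σ : ℂ) * starRingEnd ℂ (Complex.exp ((W₁.phase s).φ * Complex.I))) ^ (0:ℤ) • modeRep W₁ n 𝔹 F u (K0 + (0:ℤ) • (fun i => (W₁.phase s).m i * (n : ℤ))) t))) t := by
    filter_upwards [ae_uIcc_hasDerivAt_dW0C W₁ n hT.le h hF s K0 hσ p ht₀ ht₁] with t ht htI
    have h2 := ht htI
    rw [hcσ] at h2
    exact h2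
  have hdp' : ∀ᵐ t, t ∈ uIcc (p * W₁.period + W₁.start s) ((p * W₁.period + W₁.start s) + (W₁.phase s).τ) → HasDerivAt (fun x => ((σ : ℂ) * starRingEnd ℂ (Complex.exp ((W₁.phase s).φ * Complex.I))) ^ (1:ℤ) • modeRep W₁ n 𝔹 F u (K0 + (1:ℤ) • (fun i => (W₁.phase s).m i * (n : ℤ))) x)
      (dWpC (c * LatticeWord.trapezoid (p * W₁.period + W₁.start s) (W₁.phase s).τ W₁.ramp t) (K0 + (1:ℤ) • (fun i => (W₁.phase s).m i * (n : ℤ))) (((σ : ℂ) * starRingEnd ℂ (Complex.exp ((W₁.phase s).φ * Complex.I))) ^ (0:ℤ) • modeRep W₁ n 𝔹 F u (K0 + (0:ℤ) • (fun i => (W₁.phase s).m i * (n : ℤ))) t) (((σ : ℂ) * starRingEnd ℂ (Complex.exp ((W₁.phase s).φ * Complex.I))) ^ (2:ℤ) • modeRep W₁ n 𝔹 F u (K0 + (2:ℤ) • (fun i => (W₁.phase s).m i * (n : ℤ))) t) (Torus.modalAdjGen (Torus.majorTranspose 𝔹) (K0 + (1:ℤ) • (fun i => (W₁.phase s).m i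 * (n : ℤ))) (((σ : ℂ) * starRingEnd ℂ (Complex.exp ((W₁.phase s).φ * Complex.I))) ^ (1:ℤ) • modeRep W₁ n 𝔹 F u (K0 + (1:ℤ) • (fun i => (W₁.phase s).m i * (n : ℤ))) t))) t := by
    filter_upwards [ae_uIcc_hasDerivAt_dWpC W₁ n hT.le h hF s K0 hσ p ht₀ ht₁] with t ht htI
    have h2 := ht htI
    rw [hcσ] at h2
    exact h2
  have hdm' : ∀ᵐ t, t ∈ uIcc (p * W₁.period + W₁.start s) ((p * W₁.period + W₁.start s) + (W₁.phase s).τ) → HasDerivAt (fun x => ((σ : ℂ) * starRingEnd ℂ (Complex.exp ((W₁.phase s).φ * Complex.I))) ^ (-1:ℤ) • modeRep W₁ n 𝔹 F u (K0 + (-1:ℤ) • (fun i => (W₁.phase s).m i * (n : ℤ))) x)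
      (dWmC (c * LatticeWord.trapezoid (p * W₁.period + W₁.start s) (W₁.phase s).τ W₁.ramp t) (K0 + (-1:ℤ) • (fun i => (W₁.phase s).m i * (n : ℤ))) (((σ : ℂ) * starRingEnd ℂ (Complex.exp ((W₁.phase s).φ * Complex.I))) ^ (0:ℤ) • modeRep W₁ n 𝔹 F u (K0 + (0:ℤ) • (fun i => (W₁.phase s).m i * (n : ℤ))) t) (((σ : ℂ) * starRingEnd ℂ (Complex.exp ((W₁.phase s).φ * Complex.I))) ^ (-2:ℤ) • modeRep W₁ n 𝔹 F u (K0 + (-2:ℤ) • (fun i => (W₁.phase s).m i * (n : ℤ))) t) (Torus.modalAdjGen (Torus.majorTranspose 𝔹) (K0 + (-1:ℤ) • (fun i => (W₁.phase s).m i * (n : ℤ))) (((σ : ℂ) * starRingEnd ℂ (Complex.exp ((W₁.phase s).φ * Complex.I))) ^ (-1:ℤ) • modeRep W₁ n 𝔹 F u (K0 + (-1:ℤ) • (fun i => (W₁.phase s).m i * (n : ℤ))) t))) t := by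
    filter_upwards [ae_uIcc_hasDerivAt_dWmC W₁ n hT.le h hF s K0 hσ p ht₀ ht₁] with t ht htI
    have h2 := ht htI
    rw [hcσ] at h2
    exact h2
  -- (S1a) transversality on the slot, absolute continuity, the drain floor
  have hTj : ∀ (j : ℤ), ∀ t ∈ Icc (p * W₁.period + W₁.start s) ((p * W₁.period + W₁.start s) + (W₁.phase s).τ),
      kdot (K0 + j • (fun i => (W₁.phase s).m i * (n : ℤ))) (((σ : ℂ) * starRingEnd ℂ (Complex.exp ((W₁.phase s).φ * Complex.I))) ^ j • modeRep W₁ n 𝔹 F u (K0 + j • (fun i => (W₁.phase s).m i * (n : ℤ))) t) = 0 := by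
    intro j t htI
    rw [map_smul, kdot_modeRep W₁ n hT.le h _ (hsubI htI), smul_zero]
  have hacj : ∀ (j : ℤ), AbsolutelyContinuousOnInterval
      (fun x => ((σ : ℂ) * starRingEnd ℂ (Complex.exp ((W₁.phase s).φ * Complex.I))) ^ j • modeRep W₁ n 𝔹 F u (K0 + j • (fun i => (W₁.phase s).m i * (n : ℤ))) x) (p * W₁.period + W₁.start s) ((p * W₁.period + W₁.start s) + (W₁.phase s).τ) :=
    fun j => (absolutelyContinuousOnInterval_modeRep W₁ n hT.le h _ ht0I ht1I).const_smul _
  have hqw' : ∀ t ∈ Icc (p * W₁.period + W₁.start s) ((p * W₁.period + W₁.start s) + (W₁.phase s).τ), q * ‖(((σ : ℂ) * starRingEnd ℂ (Complex.exp ((W₁.phase s).φ * Complex.I))) ^ (0:ℤ) • modeRep W₁ n 𝔹 F u (K0 + (0:ℤ) • (fun i => (W₁.phase s).m i * (n : ℤ))) t)‖ ^ 2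
      ≤ ‖transversalProj (K0 + (1:ℤ) • (fun i => (W₁.phase s).m i * (n : ℤ))) (((σ : ℂ) * starRingEnd ℂ (Complex.exp ((W₁.phase s).φ * Complex.I))) ^ (0:ℤ) • modeRep W₁ n 𝔹 F u (K0 + (0:ℤ) • (fun i => (W₁.phase s).m i * (n : ℤ))) t)‖ ^ 2 + ‖transversalProj (K0 + (-1:ℤ) • (fun i => (W₁.phase s).m i * (n : ℤ))) (((σ : ℂ) * starRingEnd ℂ (Complex.exp ((W₁.phase s).φ * Complex.I))) ^ (0:ℤ) • modeRep W₁ n 𝔹 F u (K0 + (0:ℤ) • (fun i => (W₁.phase s).m i * (n : ℤ))) t)‖ ^ 2 :=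
    fun t htI => hqw _ (hTj 0 t htI)
  -- the energy: absolute continuity on the slot, a.e. derivative, the chain's share, the dissipation split
  have hEac' : AbsolutelyContinuousOnInterval E (p * W₁.period + W₁.start s) ((p * W₁.period + W₁.start s) + (W₁.phase s).τ) := hEac _ ht0I _ ht1I
  have hEd' : ∀ᵐ t, t ∈ uIcc (p * W₁.period + W₁.start s) ((p * W₁.period + W₁.start s) + (W₁.phase s).τ) → HasDerivAt E (-2 * Q t) t := by
    exact ae_uIcc_hasDerivAt_energy ht₀ hlt.le ht₁ hEd
  have hE5 : ∀ t ∈ Icc (p * W₁.period + W₁.start s) ((p * W₁.period + W₁.start s) + (W₁.phase s).τ), 2 * (‖(((σ : ℂ) * starRingEnd ℂ (Complex.exp ((W₁.phase s).φ * Complex.I))) ^ (0:ℤ) • modeRep W₁ n 𝔹 F u (K0 + (0:ℤ) • (fun i => (W₁.phase s).m i * (n : ℤ))) t)‖ ^ 2 + ‖(((σ : ℂ) * starRingEnd ℂ (Complex.exp ((W₁.phase s).φ * Complex.I))) ^ (1:ℤ) • modeRep W₁ n 𝔹 F u (K0 + (1:ℤ) • (fun i => (W₁.phase s).m i * (n :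 ℤ))) t)‖ ^ 2 + ‖(((σ : ℂ) * starRingEnd ℂ (Complex.exp ((W₁.phase s).φ * Complex.I))) ^ (-1:ℤ) • modeRep W₁ n 𝔹 F u (K0 + (-1:ℤ) • (fun i => (W₁.phase s).m i * (n : ℤ))) t)‖ ^ 2 + ‖(((σ : ℂ) * starRingEnd ℂ (Complex.exp ((W₁.phase s).φ * Complex.I))) ^ (2:ℤ) • modeRep W₁ n 𝔹 F u (K0 + (2:ℤ) • (fun i => (W₁.phase s).m i * (n : ℤ))) t)‖ ^ 2 + ‖(((σ : ℂ) * starRingEnd ℂ (Complex.exp ((W₁.phase s).φ * Complex.I))) ^ (-2:ℤ) • modeRep W₁ n 𝔹 F u (K0 + (-2:ℤ) • (fun i => (W₁.phase s).m i * (n : ℤ))) t)‖ ^ 2) ≤ E t := by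
    intro t htI
    exact five_norm_sq_le_energy W₁ n hT h hF s K0 hσ hKs hdisj hEcont hEae t (hsubI htI)
  have hQ' : ∀ᵐ t, t ∈ uIcc (p * W₁.period + W₁.start s) ((p * W₁.period + W₁.start s) + (W₁.phase s).τ) →
      2 * ((⟪(Torus.modalAdjGen (Torus.majorTranspose 𝔹) (K0 + (0:ℤ) • (fun i => (W₁.phase s).m i * (n : ℤ))) (((σ : ℂ) * starRingEnd ℂ (Complex.exp ((W₁.phase s).φ * Complex.I))) ^ (0:ℤ) • modeRep W₁ n 𝔹 F u (K0 + (0:ℤ) • (fun i => (W₁.phase s).m i * (n : ℤ))) t)), (((σ : ℂ) * starRingEnd ℂ (Complex.exp ((W₁.phase s).φ * Complex.I))) ^ (0:ℤ) • modeRep W₁ n 𝔹 F u (K0 + (0:ℤ) • (fun i => (W₁.phase s).m i * (n : ℤ))) t)⟫_ℂ).re + (⟪(Torus.modalAdjGen (Torus.majorTranspose 𝔹) (K0 + (1:ℤ) • (fun i => (W₁.phase s).m i * (n : ℤ))) (((σ : ℂ) * starRingEnd ℂ (Complex.exp ((W₁.phase s).φ * Complex.I))) ^ (1:ℤ) • modeRep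 W₁ n 𝔹 F u (K0 + (1:ℤ) • (fun i => (W₁.phase s).m i * (n : ℤ))) t)), (((σ : ℂ) * starRingEnd ℂ (Complex.exp ((W₁.phase s).φ * Complex.I))) ^ (1:ℤ) • modeRep W₁ n 𝔹 F u (K0 + (1:ℤ) • (fun i => (W₁.phase s).m i * (n : ℤ))) t)⟫_ℂ).re + (⟪(Torus.modalAdjGen (Torus.majorTranspose 𝔹) (K0 + (-1:ℤ) • (fun i => (W₁.phase s).m i * (n : ℤ))) (((σ : ℂ) * starRingEnd ℂ (Complex.exp ((W₁.phase s).φ * Complex.I))) ^ (-1:ℤ) • modeRep W₁ n 𝔹 F u (K0 + (-1:ℤ) • (fun i => (W₁.phase s).m i * (n : ℤ))) t)), (((σ : ℂ) * starRingEnd ℂ (Complex.exp ((W₁.phase s).φ * Complex.I))) ^ (-1:ℤ) • modeRep W₁ n 𝔹 F u (K0 + (-1:ℤ) • (fun i => (W₁.phase s).m i * (n : ℤ))) t)⟫_ℂ).re + (⟪(Torus.modalAdjGen (Torus.majorTranspose 𝔹) (K0 + (2:ℤ) • (fun i => (W₁.phase s).m i * (n : ℤ))) (((σ : ℂ) * starRingEnd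 ℂ (Complex.exp ((W₁.phase s).φ * Complex.I))) ^ (2:ℤ) • modeRep W₁ n 𝔹 F u (K0 + (2:ℤ) • (fun i => (W₁.phase s).m i * (n : ℤ))) t)), (((σ : ℂ) * starRingEnd ℂ (Complex.exp ((W₁.phase s).φ * Complex.I))) ^ (2:ℤ) • modeRep W₁ n 𝔹 F u (K0 + (2:ℤ) • (fun i => (W₁.phase s).m i * (n : ℤ))) t)⟫_ℂ).re + (⟪(Torus.modalAdjGen (Torus.majorTranspose 𝔹) (K0 + (-2:ℤ) • (fun i => (W₁.phase s).m i * (n : ℤ))) (((σ : ℂ) * starRingEnd ℂ (Complex.exp ((W₁.phase s).φ * Complex.I))) ^ (-2:ℤ) • modeRep W₁ n 𝔹 F u (K0 + (-2:ℤ) • (fun i => (W₁.phase s).m i * (n : ℤ))) t)), (((σ : ℂ) * starRingEnd ℂ (Complex.exp ((W₁.phase s).φ * Complex.I))) ^ (-2:ℤ) • modeRep W₁ n 𝔹 F u (K0 + (-2:ℤ) • (fun i => (W₁.phase s).m i * (n : ℤ))) t)⟫_ℂ).re)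
        + (dmin / 2) * (E t - 2 * (‖(((σ : ℂ) * starRingEnd ℂ (Complex.exp ((W₁.phase s).φ * Complex.I))) ^ (0:ℤ) • modeRep W₁ n 𝔹 F u (K0 + (0:ℤ) • (fun i => (W₁.phase s).m i * (n : ℤ))) t)‖ ^ 2 + ‖(((σ : ℂ) * starRingEnd ℂ (Complex.exp ((W₁.phase s).φ * Complex.I))) ^ (1:ℤ) • modeRep W₁ n 𝔹 F u (K0 + (1:ℤ) • (fun i => (W₁.phase s).m i * (n : ℤ))) t)‖ ^ 2 + ‖(((σ : ℂ) * starRingEnd ℂ (Complex.exp ((W₁.phase s).φ * Complex.I))) ^ (-1:ℤ) • modeRep W₁ n 𝔹 F u (K0 + (-1:ℤ) • (fun i => (W₁.phase s).m i * (n : ℤ))) t)‖ ^ 2 + ‖(((σ : ℂ) * starRingEnd ℂ (Complex.exp ((W₁.phase s).φ * Complex.I))) ^ (2:ℤ) • modeRep W₁ n 𝔹 F u (K0 + (2:ℤ) • (fun i => (W₁.phase s).m i * (n : ℤ))) t)‖ ^ 2 + ‖(((σ : ℂ) * starRingEnd ℂ (Complex.exp ((W₁.phase s).φ * Complex.I)))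 ^ (-2:ℤ) • modeRep W₁ n 𝔹 F u (K0 + (-2:ℤ) • (fun i => (W₁.phase s).m i * (n : ℤ))) t)‖ ^ 2)) ≤ Q t := by
    exact ae_uIcc_pair_split W₁ n hT.le h hF h𝔹 s K0 hσ hKs hdisj hEae hQS hdmin.le hgap ht₀ hlt.le ht₁
  -- THE ABSTRACT SLOT STEP
  have hstep := slot_step_on h𝔹' hlo.le hhi hodd' hβ hKp hKm hlt (μ := 2) (by norm_num) hc0 hε hdmin hdtwo
    hdp hdm hdpp hdmm hDp hDm hdD c1 c2 c3 c4 (continuous_trapezoid _ _ _) hA01 (trapezoid_left hτ hρ _)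
    (trapezoid_right hτ hρ _) (absolutelyContinuousOnInterval_trapezoid _ hτ hρ _ _) hAd1 hAd2
    (hTj 0) (hTj 1) (hTj (-1)) (hTj 2) (hTj (-2)) hqw' (hacj 0) (hacj 1) (hacj (-1)) hd0 hdp' hdm' hEac' hEd' hE5 hQ'
  rw [hτeq] at hstep
  have hI := slot_rate_floor (t₀ := (p * W₁.period + W₁.start s)) hε hq0 hq2 hdmin hτ hramp c1 c3 c5
  have hE0 : 0 ≤ E (p * W₁.period + W₁.start s) := by
    have h5 := hE5 (p * W₁.period + W₁.start s) ⟨le_rfl, hlt.le⟩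
    have : 0 ≤ ‖(((σ : ℂ) * starRingEnd ℂ (Complex.exp ((W₁.phase s).φ * Complex.I))) ^ (0:ℤ) • modeRep W₁ n 𝔹 F u (K0 + (0:ℤ) • (fun i => (W₁.phase s).m i * (n : ℤ))) (p * W₁.period + W₁.start s))‖ ^ 2 + ‖(((σ : ℂ) * starRingEnd ℂ (Complex.exp ((W₁.phase s).φ * Complex.I))) ^ (1:ℤ) • modeRep W₁ n 𝔹 F u (K0 + (1:ℤ) • (fun i => (W₁.phase s).m i * (n : ℤ))) (p * W₁.period + W₁.start s))‖ ^ 2 + ‖(((σ : ℂ) * starRingEnd ℂ (Complex.exp ((W₁.phase s).φ * Complex.I))) ^ (-1:ℤ) • modeRep W₁ n 𝔹 F u (K0 + (-1:ℤ) • (fun i => (W₁.phase s).m i * (n : ℤ))) (p * W₁.period + W₁.start s))‖ ^ 2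
        + ‖(((σ : ℂ) * starRingEnd ℂ (Complex.exp ((W₁.phase s).φ * Complex.I))) ^ (2:ℤ) • modeRep W₁ n 𝔹 F u (K0 + (2:ℤ) • (fun i => (W₁.phase s).m i * (n : ℤ))) (p * W₁.period + W₁.start s))‖ ^ 2 + ‖(((σ : ℂ) * starRingEnd ℂ (Complex.exp ((W₁.phase s).φ * Complex.I))) ^ (-2:ℤ) • modeRep W₁ n 𝔹 F u (K0 + (-2:ℤ) • (fun i => (W₁.phase s).m i * (n : ℤ))) (p * W₁.period + W₁.start s))‖ ^ 2 := by positivity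
    linarith
  calc E ((p * W₁.period + W₁.start s) + (W₁.phase s).τ) ≤ _ := hstep
    _ ≤ Real.exp (-(ε * c ^ 2 * q * (W₁.phase s).τ / 27)) * E (p * W₁.period + W₁.start s) :=
        mul_le_mul_of_nonneg_right (Real.exp_le_exp.2 (by linarith)) hE0

end Summit.AnomalousDissipation.AnomalousDissipation.Theorems.SolenoidalFractalHomogenisation.LagrangianStep.W7Cell

end
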